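import Summits.Ventures.PercRepro0.Bubble
import Summits.Ventures.PercRepro0.ChiCritical

/-!
# PM-D · CHI-LOWER on the cell's definitions, part 1: the finite-volume susceptibility and Lemmas A–B
(seat p2, block-M census evidence; BK as an explicit hypothesis)

Part 1 of the Lean twin of route/TMID-CENSUS-v7-plan-2.md §3.4 (PM-D · CHI-LOWER, Lemmas A–D, as re-derived
by rev-2 in REVIEW-TMID-CENSUS-v7-plan-2-rev-2 §3 and by rev-1 on 2026-08-26T05:02:49Z), written on the lead's
RULING F (7)(d′) of 2026-08-26T05:05:07Z, on the tree's own objects (part 2 = `ChiLower.lean`: Lemmas C–D,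
the theorem and its corollary):

* `χ` is `PcChi.chi d p = ∑' x, P_p(0 ↔ x)` (extended real) — no new `χ`, no new `τ`; `one_le_chi`, `chi_mono`,
  and `chi_clamp_lt_top` (`χ_q < ∞` for `0 ≤ q < p_c(d)` = S5, `PcChi.chi_lt_top_of_lt_pc` with P5 discharged
  by `Sharp.P5_Sharpness_holds'`);
* `chiBoxE d n p = Σ_{x ∈ Λ_n} P_p(0 ↔_{Λ_n} x)` is the finite-volume susceptibility `χ^n` (`chiBox` = its real,
  clamped form, a finite sum of p4's Russo polynomials); `χ^n ≥ 1`, `χ^n ≤ χ`, non-decreasing in `n`;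
* **monotone convergence** `chi_eq_iSup_chiBoxE` / `tendsto_chiBox`: `χ^n ↑ χ` (`conn_eq_iUnion_boxConn` and
  `Monotone.measure_iUnion` for each `x`, `ENNReal.finsetSum_iSup_of_monotone`, `ENNReal.tsum_eq_iSup_sum`);
* **Lemma A** `sum_sum_piv_le` (given `Bubble.BK d`): `Σ_{x ∈ Λ_n} Σ_{e ∈ E(Λ_n)} P_p(e pivotal for {0 ↔_{Λ_n} x})
  ≤ 2d · χ_p · χ_p` — the pivotal bound `Bubble.P_piv_le` (pivotal inclusion `piv_subset_disjOcc` + BK), F2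
  (`Bubble.P_conn_eq_sub`) for `Σ_x τ(v,x) ≤ χ`, and `≤ 2d` bonds at each vertex (`Bubble.sum_obonds_fst_le`);
  `sum_dtau_le` is its real, derivative form `(χ^n)'(q) ≤ 2d χ_q²` (Russo's formula `hasDerivAt_chiBox` =
  `Bubble.hasDerivAt_tauBox` summed over `Λ_n`);
* **Lemma B** `chiBox_sub_le` / `chi_sub_le` (given BK): `χ_b − χ_a ≤ 2d χ_b² (b − a)` for `0 ≤ a ≤ b ≤ 1` with
  `χ_b < ∞` — the mean value inequality for the polynomial `χ^n` on `[a, b]` (`Convex.image_sub_le_mul_sub_of_deriv_le`,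
  Russo's derivative on the interior only), then `n → ∞` by `tendsto_chiBox`.

The hypothesis `hBK : Bubble.BK d` is P10 · BK in p4's named form (module DisjOcc); it is discharged by
`Bubble.BK_holds` (BubbleClose, from p2's `BK.P_disjointOcc_le`) in a separate Close module.

This is preparatory material for a LOWER bound on `χ` below `p_c(d)`: census evidence only, off every declaration
path, not a door, not a status change; NOTHING here asserts anything about `B_q`, `∫ B_q dq` or `T(d)` for any
`3 ≤ d ≤ 10`.
-/

namespace Summit.Ventures.PercRepro0.ChiLower

open MeasureTheory ProbabilityTheory unitInterval Set Filter Topology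
open Summit.Ventures.PercRepro0.Defs
open Summit.Ventures.PercRepro0.Sharp
open Summit.Ventures.PercRepro0.Bubble
open Summit.Ventures.PercRepro0.PcChi (chi chi_lt_top_of_lt_pc coe_clamp_of_mem nrm abs_le_nrm)
open scoped ENNReal NNReal Classical

variable {d : ℕ}
/-! ### The susceptibility: `χ ≥ 1`, monotone, finite below `p_c` -/

/-- `{x ↔ x}` is everything, so `P_p(x ↔ x) = 1`. -/
theorem P_conn_self (p : I) (x : Vertex d) : P d p {ω : Config d | Conn d ω x x} = 1 := by
  have h : {ω : Config d | Conn d ω x x} = Set.univ :=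
    Set.eq_univ_of_forall fun _ => SimpleGraph.Reachable.refl x
  rw [h, measure_univ]

/-- `1 ≤ χ_p` (the term `x = 0`). -/
theorem one_le_chi (p : I) : 1 ≤ chi d p := by
  rw [chi]
  calc (1 : ℝ≥0∞) = P d p {ω : Config d | Conn d ω 0 0} := (P_conn_self p 0).symm
    _ ≤ ∑' x : Vertex d, P d p {ω : Config d | Conn d ω 0 x} := ENNReal.le_tsum 0

/-- `p ↦ χ_p` is non-decreasing (L1 on the increasing events `{0 ↔ x}`). -/
theorem chi_mono : Monotone (chi d) := fun p q hpq =>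
  ENNReal.tsum_le_tsum fun x =>
    L1_Monotone_holds d p q hpq _ (isUpperSet_conn 0 x) (measurableSet_conn 0 x)

/-- `χ_q < ∞` for `0 ≤ q < p_c(d)` (S5, with sharpness discharged by `Sharp.P5_Sharpness_holds'`). -/
theorem chi_clamp_lt_top (hd : 1 ≤ d) {q : ℝ} (hq0 : 0 ≤ q) (hq : q < pc d) :
    chi d (clamp q) < ⊤ := by
  apply chi_lt_top_of_lt_pc hd (Sharp.P5_Sharpness_holds' d) (clamp q)
  rw [coe_clamp_of_mem ⟨hq0, hq.le.trans (pc_le_one hd)⟩]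
  exact hq

/-- `clamp` is monotone. -/
theorem clamp_mono {a b : ℝ} (hab : a ≤ b) : clamp a ≤ clamp b :=
  Set.monotone_projIcc zero_le_one hab

/-- `1 ≤ χ_q` as a real number when `χ_q < ∞`. -/
theorem one_le_chi_toReal (p : I) (hfin : chi d p ≠ ⊤) : 1 ≤ (chi d p).toReal := by
  have h := ENNReal.toReal_mono hfin (one_le_chi p)
  rwa [ENNReal.toReal_one] at h

/-! ### The finite-volume susceptibility `χ^n` -/

/-- `χ^n_p = Σ_{x ∈ Λ_n} P_p(0 ↔_{Λ_n} x)` (extended real). -/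
noncomputable def chiBoxE (d n : ℕ) (p : I) : ℝ≥0∞ := ∑ x ∈ boxF d n, P d p (boxConn d n 0 x)

/-- `χ^n` as a real function of `q ∈ ℝ` (clamped): a finite sum of Russo polynomials. -/
noncomputable def chiBox (d n : ℕ) (q : ℝ) : ℝ := ∑ x ∈ boxF d n, (P d (clamp q) (boxConn d n 0 x)).toReal

/-- `χ^n_p < ∞`. -/
theorem chiBoxE_ne_top (n : ℕ) (p : I) : chiBoxE d n p ≠ ⊤ :=
  ENNReal.sum_ne_top.2 fun _ _ => measure_ne_top _ _

/-- The real form is the `toReal` of the extended form. -/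
theorem toReal_chiBoxE (n : ℕ) (q : ℝ) : (chiBoxE d n (clamp q)).toReal = chiBox d n q := by
  unfold chiBoxE chiBox
  rw [ENNReal.toReal_sum fun _ _ => measure_ne_top _ _]

/-- `χ^n_p ≤ χ_p`. -/
theorem chiBoxE_le_chi (n : ℕ) (p : I) : chiBoxE d n p ≤ chi d p :=
  calc chiBoxE d n p ≤ ∑ x ∈ boxF d n, P d p {ω : Config d | Conn d ω 0 x} :=
        Finset.sum_le_sum fun x _ => P_boxConn_le p n 0 x
    _ ≤ chi d p := ENNReal.sum_le_tsum _

/-- `1 ≤ χ^n_p` (the term `x = 0 ∈ Λ_n`). -/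
theorem one_le_chiBoxE (n : ℕ) (p : I) : 1 ≤ chiBoxE d n p := by
  have h0 : (0 : Vertex d) ∈ boxF d n := mem_boxF.2 (zero_mem_box n)
  have h1 : P d p (boxConn d n 0 0) = 1 := by
    have h : boxConn d n (0 : Vertex d) 0 = Set.univ :=
      Set.eq_univ_of_forall fun _ => SimpleGraph.Reachable.refl (0 : Vertex d)
    rw [h, measure_univ]
  calc (1 : ℝ≥0∞) = P d p (boxConn d n 0 0) := h1.symm
    _ ≤ chiBoxE d n p :=
        Finset.single_le_sum (f := fun x => P d p (boxConn d n 0 x)) (fun _ _ => zero_le) h0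

/-- `1 ≤ χ^n` (real form). -/
theorem one_le_chiBox (n : ℕ) (q : ℝ) : 1 ≤ chiBox d n q := by
  have h := ENNReal.toReal_mono (chiBoxE_ne_top (d := d) n (clamp q)) (one_le_chiBoxE (d := d) n (clamp q))
  rwa [ENNReal.toReal_one, toReal_chiBoxE] at h

/-- The boxes grow with `n`. -/
theorem boxF_mono : Monotone (boxF d) := fun n m hnm x hx => by
  rw [mem_boxF] at hx ⊢
  intro i
  exact (hx i).trans (by exact_mod_cast hnm)

/-- `χ^n_p` is non-decreasing in `n`. -/
theorem chiBoxE_mono_n (p : I) : Monotone fun n : ℕ => chiBoxE d n p := fun n m hnm =>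
  calc chiBoxE d n p = ∑ x ∈ boxF d n, P d p (boxConn d n 0 x) := rfl
    _ ≤ ∑ x ∈ boxF d n, P d p (boxConn d m 0 x) :=
        Finset.sum_le_sum fun x _ => measure_mono (boxConn_monotone 0 x hnm)
    _ ≤ ∑ x ∈ boxF d m, P d p (boxConn d m 0 x) := Finset.sum_le_sum_of_subset (boxF_mono hnm)

/-! ### Monotone convergence: `χ^n ↑ χ` -/

/-- Every finite set of vertices lies in some box. -/
theorem exists_subset_boxF (S : Finset (Vertex d)) : ∃ N : ℕ, S ⊆ boxF d N := by
  refine ⟨S.sup nrm, fun x hx => ?_⟩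
  rw [mem_boxF]
  intro i
  have h1 : nrm x ≤ S.sup nrm := Finset.le_sup (f := nrm) hx
  exact (abs_le_nrm x i).trans (by exact_mod_cast h1)

/-- `τ_p(x,y) = ⨆_n P_p(x ↔_{Λ_n} y)` (continuity from below along `conn_eq_iUnion_boxConn`). -/
theorem P_conn_eq_iSup (p : I) (x y : Vertex d) :
    P d p {ω : Config d | Conn d ω x y} = ⨆ n : ℕ, P d p (boxConn d n x y) := by
  rw [conn_eq_iUnion_boxConn]
  exact (boxConn_monotone x y).measure_iUnion

/-- `χ_p = ⨆_n χ^n_p` (monotone convergence for the series). -/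
theorem chi_eq_iSup_chiBoxE (p : I) : chi d p = ⨆ n : ℕ, chiBoxE d n p := by
  refine le_antisymm ?_ (iSup_le fun n => chiBoxE_le_chi n p)
  rw [chi, ENNReal.tsum_eq_iSup_sum]
  refine iSup_le fun S => ?_
  obtain ⟨N, hSN⟩ := exists_subset_boxF S
  calc ∑ x ∈ S, P d p {ω : Config d | Conn d ω 0 x}
      = ∑ x ∈ S, ⨆ n : ℕ, P d p (boxConn d n 0 x) :=
        Finset.sum_congr rfl fun x _ => P_conn_eq_iSup p 0 x
    _ = ⨆ n : ℕ, ∑ x ∈ S, P d p (boxConn d n 0 x) :=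
        ENNReal.finsetSum_iSup_of_monotone (f := fun x n => P d p (boxConn d n 0 x))
          fun x _ _ hnm => measure_mono (boxConn_monotone 0 x hnm)
    _ ≤ ⨆ n : ℕ, chiBoxE d n p := by
        refine iSup_mono' fun n => ⟨max n N, ?_⟩
        calc ∑ x ∈ S, P d p (boxConn d n 0 x)
            ≤ ∑ x ∈ S, P d p (boxConn d (max n N) 0 x) :=
              Finset.sum_le_sum fun x _ => measure_mono (boxConn_monotone 0 x (le_max_left n N))
          _ ≤ ∑ x ∈ boxF d (max n N), P d p (boxConn d (max n N) 0 x) :=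
              Finset.sum_le_sum_of_subset (hSN.trans (boxF_mono (le_max_right n N)))

/-- `χ^n_p → χ_p` as `n → ∞` (extended reals). -/
theorem tendsto_chiBoxE (p : I) : Tendsto (fun n : ℕ => chiBoxE d n p) atTop (𝓝 (chi d p)) := by
  rw [chi_eq_iSup_chiBoxE]
  exact tendsto_atTop_iSup (chiBoxE_mono_n p)

/-- `χ^n_q → χ_q` as `n → ∞` (real form, for `χ_q < ∞`). -/
theorem tendsto_chiBox (q : ℝ) (hfin : chi d (clamp q) ≠ ⊤) :
    Tendsto (fun n : ℕ => chiBox d n q) atTop (𝓝 (chi d (clamp q)).toReal) := by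
  have h := (ENNReal.tendsto_toReal hfin).comp (tendsto_chiBoxE (clamp q))
  exact h.congr fun n => toReal_chiBoxE n q

/-! ### Lemma A: the pivotal sum -/

/-- Each bond of `Λ_n` is bounded by its two orientations (the pivotal bound `P_piv_le`, given BK):
`Σ_{e ∈ E(Λ_n)} P_p(e pivotal for {0 ↔_{Λ_n} x}) ≤ Σ_{(u,v) ∈ obonds} τ_p(0,u) τ_p(v,x)`. -/
theorem sum_piv_le_obonds (hBK : BK d) (p : I) (n : ℕ) (x : Vertex d) :
    ∑ e ∈ boxBondsF d n, P d p (Russo.Piv e (boxConn d n 0 x)) ≤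
      ∑ uv ∈ obonds d n, P d p {ω : Config d | Conn d ω 0 uv.1} * P d p {ω : Config d | Conn d ω uv.2 x} := by
  classical
  set G : Vertex d × Vertex d → ℝ≥0∞ := fun uv =>
    P d p {ω : Config d | Conn d ω 0 uv.1} * P d p {ω : Config d | Conn d ω uv.2 x} with hG
  have hfib : ∀ e ∈ boxBondsF d n, P d p (Russo.Piv e (boxConn d n 0 x)) ≤
      ∑ uv ∈ (obonds d n).filter (fun uv => s(uv.1, uv.2) = e), G uv := by
    intro e he
    induction e using Sym2.ind with
    | _ a b =>
      have hab : (lattice d).Adj a b := by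
        have h := (mem_boxBondsF.1 he).1
        exact ((lattice d).mem_edgeSet).1 h
      have hne : a ≠ b := (lattice d).ne_of_adj hab
      have hbox : ∀ v ∈ s(a, b), v ∈ box d n := (mem_boxBondsF.1 he).2
      have hpair : ({(a, b), (b, a)} : Finset (Vertex d × Vertex d)) ⊆
          (obonds d n).filter (fun uv => s(uv.1, uv.2) = s(a, b)) := by
        intro uv huv
        rw [Finset.mem_insert, Finset.mem_singleton] at huv
        rw [Finset.mem_filter, mem_obonds]
        rcases huv with rfl | rfl
        · exact ⟨⟨⟨hbox a (Sym2.mem_mk_left a b), hbox b (Sym2.mem_mk_right a b)⟩, hab⟩, rfl⟩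
        · exact ⟨⟨⟨hbox b (Sym2.mem_mk_right a b), hbox a (Sym2.mem_mk_left a b)⟩, hab.symm⟩, Sym2.eq_swap⟩
      have hne' : ((a, b) : Vertex d × Vertex d) ≠ (b, a) := fun h => hne (Prod.mk.inj h).1
      calc P d p (Russo.Piv s(a, b) (boxConn d n 0 x))
          ≤ P d p {ω : Config d | Conn d ω 0 a} * P d p {ω : Config d | Conn d ω b x} +
              P d p {ω : Config d | Conn d ω 0 b} * P d p {ω : Config d | Conn d ω a x} :=
            P_piv_le hBK p n x a b
        _ = ∑ uv ∈ ({(a, b), (b, a)} : Finset (Vertex d × Vertex d)), G uv := by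
            rw [Finset.sum_pair hne']
        _ ≤ ∑ uv ∈ (obonds d n).filter (fun uv => s(uv.1, uv.2) = s(a, b)), G uv :=
            Finset.sum_le_sum_of_subset hpair
  have hmaps : ∀ uv ∈ obonds d n, s(uv.1, uv.2) ∈ boxBondsF d n := fun uv huv => mk_mem_boxBondsF huv
  calc ∑ e ∈ boxBondsF d n, P d p (Russo.Piv e (boxConn d n 0 x))
      ≤ ∑ e ∈ boxBondsF d n, ∑ uv ∈ (obonds d n).filter (fun uv => s(uv.1, uv.2) = e), G uv :=
        Finset.sum_le_sum hfib
    _ = ∑ uv ∈ obonds d n, G uv := Finset.sum_fiberwise_of_maps_to hmaps G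

/-- F2 summed over a box: `Σ_{x ∈ Λ_n} τ_p(v,x) ≤ χ_p` (`P_conn_eq_sub` and a reindexing `x ↦ x − v`). -/
theorem sum_P_conn_snd_le_chi (p : I) (n : ℕ) (v : Vertex d) :
    ∑ x ∈ boxF d n, P d p {ω : Config d | Conn d ω v x} ≤ chi d p := by
  have hinj : Set.InjOn (fun x : Vertex d => x - v) ↑(boxF d n) :=
    fun a _ b _ hab => sub_left_injective hab
  calc ∑ x ∈ boxF d n, P d p {ω : Config d | Conn d ω v x}
      = ∑ x ∈ boxF d n, P d p {ω : Config d | Conn d ω 0 (x - v)} :=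
        Finset.sum_congr rfl fun x _ => P_conn_eq_sub p v x
    _ = ∑ w ∈ (boxF d n).image (fun x => x - v), P d p {ω : Config d | Conn d ω 0 w} := by
        rw [Finset.sum_image hinj]
    _ ≤ chi d p := ENNReal.sum_le_tsum _

/-- **Lemma A** (given BK): `Σ_{x ∈ Λ_n} Σ_{e ∈ E(Λ_n)} P_p(e pivotal for {0 ↔_{Λ_n} x}) ≤ 2d · χ_p · χ_p`
(pivotal bound, F2, and at most `2d` bonds at each vertex of `Λ_n`). -/
theorem sum_sum_piv_le (hBK : BK d) (p : I) (n : ℕ) :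
    ∑ x ∈ boxF d n, ∑ e ∈ boxBondsF d n, P d p (Russo.Piv e (boxConn d n 0 x)) ≤
      2 * d * (chi d p * chi d p) :=
  calc ∑ x ∈ boxF d n, ∑ e ∈ boxBondsF d n, P d p (Russo.Piv e (boxConn d n 0 x))
      ≤ ∑ x ∈ boxF d n, ∑ uv ∈ obonds d n,
          P d p {ω : Config d | Conn d ω 0 uv.1} * P d p {ω : Config d | Conn d ω uv.2 x} :=
        Finset.sum_le_sum fun x _ => sum_piv_le_obonds hBK p n x
    _ = ∑ uv ∈ obonds d n, P d p {ω : Config d | Conn d ω 0 uv.1} *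
          ∑ x ∈ boxF d n, P d p {ω : Config d | Conn d ω uv.2 x} := by
        rw [Finset.sum_comm]
        exact Finset.sum_congr rfl fun uv _ => (Finset.mul_sum _ _ _).symm
    _ ≤ ∑ uv ∈ obonds d n, P d p {ω : Config d | Conn d ω 0 uv.1} * chi d p :=
        Finset.sum_le_sum fun uv _ => mul_le_mul_right (sum_P_conn_snd_le_chi p n uv.2) _
    _ = (∑ uv ∈ obonds d n, P d p {ω : Config d | Conn d ω 0 uv.1}) * chi d p := by
        rw [Finset.sum_mul]
    _ ≤ (2 * d * ∑ u ∈ boxF d n, P d p {ω : Config d | Conn d ω 0 u}) * chi d p :=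
        mul_le_mul_left (sum_obonds_fst_le n fun u => P d p {ω : Config d | Conn d ω 0 u}) _
    _ ≤ (2 * d * chi d p) * chi d p :=
        mul_le_mul_left (mul_le_mul_right (ENNReal.sum_le_tsum _) _) _
    _ = 2 * d * (chi d p * chi d p) := by ring

/-! ### Lemma B: the integrated inequality -/

/-- Russo's formula for `χ^n` (a finite sum of `Bubble.hasDerivAt_tauBox`). -/
theorem hasDerivAt_chiBox (n : ℕ) {q : ℝ} (hq0 : 0 < q) (hq1 : q < 1) :
    HasDerivAt (chiBox d n) (∑ x ∈ boxF d n, dtau n x q) q := by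
  unfold chiBox
  exact HasDerivAt.fun_sum fun x _ => hasDerivAt_tauBox n x hq0 hq1

/-- `χ^n` is continuous in `q`. -/
theorem continuous_chiBox (n : ℕ) : Continuous (chiBox d n) := by
  unfold chiBox
  exact continuous_finsetSum _ fun x _ => continuous_tau_box n 0 x

/-- Lemma A in real, derivative form: `(χ^n)'(q) ≤ 2d χ_q²` when `χ_q < ∞` (given BK). -/
theorem sum_dtau_le (hBK : BK d) (n : ℕ) (q : ℝ) (hfin : chi d (clamp q) ≠ ⊤) :
    ∑ x ∈ boxF d n, dtau n x q ≤ 2 * d * (chi d (clamp q)).toReal ^ 2 := by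
  have h1 : ENNReal.ofReal (∑ x ∈ boxF d n, dtau n x q) ≤
      2 * d * (chi d (clamp q) * chi d (clamp q)) := by
    rw [ENNReal.ofReal_sum_of_nonneg fun x _ => dtau_nonneg n x q]
    calc ∑ x ∈ boxF d n, ENNReal.ofReal (dtau n x q)
        = ∑ x ∈ boxF d n, ∑ e ∈ boxBondsF d n, P d (clamp q) (Russo.Piv e (boxConn d n 0 x)) := by
          refine Finset.sum_congr rfl fun x _ => ?_
          unfold dtau
          rw [ENNReal.ofReal_sum_of_nonneg fun _ _ => ENNReal.toReal_nonneg]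
          exact Finset.sum_congr rfl fun e _ => ENNReal.ofReal_toReal (measure_ne_top _ _)
      _ ≤ 2 * d * (chi d (clamp q) * chi d (clamp q)) := sum_sum_piv_le hBK (clamp q) n
  have h2 : (2 * d * (chi d (clamp q) * chi d (clamp q)) : ℝ≥0∞) ≠ ⊤ :=
    ENNReal.mul_ne_top (ENNReal.mul_ne_top ENNReal.ofNat_ne_top (ENNReal.natCast_ne_top d))
      (ENNReal.mul_ne_top hfin hfin)
  have h3 := ENNReal.toReal_mono h2 h1
  rw [ENNReal.toReal_ofReal (Finset.sum_nonneg fun x _ => dtau_nonneg n x q)] at h3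
  calc ∑ x ∈ boxF d n, dtau n x q ≤ (2 * d * (chi d (clamp q) * chi d (clamp q))).toReal := h3
    _ = 2 * d * (chi d (clamp q)).toReal ^ 2 := by
        simp only [ENNReal.toReal_mul, ENNReal.toReal_ofNat, ENNReal.toReal_natCast]
        ring

/-- **Lemma B, finite volume** (given BK): for `0 ≤ a ≤ b ≤ 1` with `χ_b < ∞`,
`χ^n_b − χ^n_a ≤ 2d χ_b² (b − a)` (mean value inequality on `[a, b]`, Russo's derivative on the interior). -/
theorem chiBox_sub_le (hBK : BK d) (n : ℕ) {a b : ℝ} (ha : 0 ≤ a) (hab : a ≤ b) (hb : b ≤ 1)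
    (hfin : chi d (clamp b) ≠ ⊤) :
    chiBox d n b - chiBox d n a ≤ 2 * d * (chi d (clamp b)).toReal ^ 2 * (b - a) := by
  have hcont : ContinuousOn (chiBox d n) (Set.Icc a b) := (continuous_chiBox n).continuousOn
  have hderiv : ∀ q ∈ interior (Set.Icc a b),
      HasDerivAt (chiBox d n) (∑ x ∈ boxF d n, dtau n x q) q := by
    intro q hq
    rw [interior_Icc] at hq
    exact hasDerivAt_chiBox n (lt_of_le_of_lt ha hq.1) (lt_of_lt_of_le hq.2 hb)
  have hdiff : DifferentiableOn ℝ (chiBox d n) (interior (Set.Icc a b)) :=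
    fun q hq => (hderiv q hq).differentiableAt.differentiableWithinAt
  have hbound : ∀ q ∈ interior (Set.Icc a b),
      deriv (chiBox d n) q ≤ 2 * d * (chi d (clamp b)).toReal ^ 2 := by
    intro q hq
    rw [(hderiv q hq).deriv]
    have hq' := hq
    rw [interior_Icc] at hq'
    have hmono : chi d (clamp q) ≤ chi d (clamp b) := chi_mono (clamp_mono hq'.2.le)
    have hfinq : chi d (clamp q) ≠ ⊤ := ne_top_of_le_ne_top hfin hmono
    calc ∑ x ∈ boxF d n, dtau n x q ≤ 2 * d * (chi d (clamp q)).toReal ^ 2 := sum_dtau_le hBK n q hfinq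
      _ ≤ 2 * d * (chi d (clamp b)).toReal ^ 2 :=
          mul_le_mul_of_nonneg_left
            (pow_le_pow_left₀ ENNReal.toReal_nonneg (ENNReal.toReal_mono hfin hmono) 2) (by positivity)
  exact (convex_Icc a b).image_sub_le_mul_sub_of_deriv_le hcont hdiff hbound a
    (Set.left_mem_Icc.2 hab) b (Set.right_mem_Icc.2 hab) hab

/-- **Lemma B** (given BK): for `0 ≤ a ≤ b ≤ 1` with `χ_b < ∞`, `χ_b − χ_a ≤ 2d χ_b² (b − a)`
(the finite-volume bound passed to `n → ∞`). -/
theorem chi_sub_le (hBK : BK d) {a b : ℝ} (ha : 0 ≤ a) (hab : a ≤ b) (hb : b ≤ 1)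
    (hfin : chi d (clamp b) ≠ ⊤) :
    (chi d (clamp b)).toReal - (chi d (clamp a)).toReal ≤
      2 * d * (chi d (clamp b)).toReal ^ 2 * (b - a) := by
  have hfina : chi d (clamp a) ≠ ⊤ := ne_top_of_le_ne_top hfin (chi_mono (clamp_mono hab))
  have h1 := (tendsto_chiBox b hfin).sub (tendsto_chiBox a hfina)
  exact le_of_tendsto' h1 fun n => chiBox_sub_le hBK n ha hab hb hfin

/-- `χ_q ≠ ∞` for `0 ≤ q < p_c(d)` (the `≠ ⊤` form of `chi_clamp_lt_top`, the binder Lemma B / C take). -/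
theorem chi_clamp_ne_top (hd : 1 ≤ d) {q : ℝ} (hq0 : 0 ≤ q) (hq : q < pc d) : chi d (clamp q) ≠ ⊤ :=
  (chi_clamp_lt_top hd hq0 hq).ne

end Summit.Ventures.PercRepro0.ChiLower
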